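import Literature.Analysis.ValidatedNumerics.TaylorModelIntegralCertFamily
import Literature.Analysis.ValidatedNumerics.TaylorModelSinCosWide
import HarnessLib

/-!
# The statement families with `sin` / `cos` modelled WITHOUT a range condition

Trunk T-ANA (Analysis/ValidatedNumerics); namespace `Literature.Analysis.ValidatedNumerics.PolyMP`.
Two more instances of the generic certificate machinery of `TaylorModelIntegralCertFamily.lean` (Melquiond, IJCAR
2008, Sect. 3.3: the evaluator of a straight-line program is generic in the operations):

* `TOp.modelW` / **`TOp.tmem_modelW`** — the statement modeller of `TaylorModelIntegralCertTrig.lean` with `sin i`,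
  `cos i` modelled by `tsinTMWS` / `tcosTMWS` of `TaylorModelSinCosWide.lean` (Lagrange remainders of the real series
  at every argument, Joldeş's `TMSin`: NO `|u| ≤ 1` acceptance condition on the centred operand `u`; Horner evaluation
  in the scaled variable `u²/4^m ≤ 1`) instead of `tsinTM` / `tcosTM`; every `base` statement as in `SOp.model`;
* `AOp.modelSW` / **`AOp.tmem_modelSW`** — the same under `arctan` statements, those modelled by the sharp `tatanTMS`
  of `TaylorModelArctanSharp.lean` (as in `AOp.modelS`);
* the families `OpModel.trigWide` / `OpSem.trigWide` and `OpModel.atanSharpWide` / `OpSem.atanSharpWide`, with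
  `toFunP_trigWide`, `toFunP_atanSharpWide`: the programs and their denoted functions are those of `TProg` / `AProg`
  (same `evalF`), only the modeller differs — so `M.certCheck` / `M.panelCheck` of the generic file, at these families,
  certify `∫ TProg.toFunP p ps · q` / `∫ AProg.toFunP p ps · q` for panels on which the operand of a `sin` / `cos`
  varies by more than `1`.

Problem-independent plumbing; no facts, no axioms.

## References

* G. Melquiond, *Proving bounds on real-valued functions with computations*, IJCAR 2008, LNCS 5195, 2–17, Sect. 3.3
  (straight-line programs; the evaluator generic in the operations). [cite: Melquiond2008, Sect. 3.3]
* M. Joldeş, *Rigorous Polynomial Approximations and Applications*, PhD thesis, ENS Lyon (2011): Algorithm 2.2.3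
  (`TMSin` on an arbitrary interval), Algorithm 2.2.10 (Taylor models of an expression by structural recursion).
  [cite: Joldes2011, Algorithm 2.2.10]
* A. Mahboubi, G. Melquiond, T. Sibut-Pinote, *Formally verified approximations of definite integrals*, ITP 2016,
  LNCS 9807, 274–289, Sect. 4.1 (programs on an initial stack of constants). [cite: MahboubiMelquiondSibutpinote2016, Sect. 4.1]
-/

open MeasureTheory intervalIntegral Set

namespace Literature.Analysis.ValidatedNumerics

namespace PolyMP

open Literature.Analysis.ValidatedNumerics.NumericsMP
open Literature.Analysis.ValidatedNumerics.ExpPoly (Poly BPoly)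
open Literature.Analysis.ValidatedNumerics.ExpPoly

namespace TOp

/-- **The statement modeller with range-free `sin` / `cos`**: `SOp.model` for a `base` statement, `tsinTMWS` /
`tcosTMWS` of the operand's register model for `sin` / `cos`. [cite: Joldes2011, Algorithm 2.2.10] -/
def modelW (S : ℕ) (h : ℚ) (D K Ke ke Kl Kt kt : ℕ) (c : ℚ) (Ws : List IPoly) :
    TOp → List (List ℤ × ℕ) → WExpr.MRes
  | base op, cs => op.model S h D K Ke ke Kl c Ws cs
  | sin i, cs =>
      let t := tsinTMWS S h D K Kt kt (getReg [] Ws i)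
      ⟨t.1, cs, t.2⟩
  | cos i, cs =>
      let t := tcosTMWS S h D K Kt kt (getReg [] Ws i)
      ⟨t.1, cs, t.2⟩

/-- **Soundness of `TOp.modelW`** under the stack invariant. [cite: Joldes2011, Algorithm 2.2.10] -/
theorem tmem_modelW {S : ℕ} (hS : 0 < S) {h : ℚ} (h0 : 0 ≤ h) {D K Ke ke Kl Kt kt : ℕ} (c : ℚ)
    {fs : List (ℝ → ℝ)} {Ws : List IPoly} (hst : StackMem S h c fs Ws) :
    ∀ (op : TOp) (cs : List (List ℤ × ℕ)), (op.modelW S h D K Ke ke Kl Kt kt c Ws cs).ok = true →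
      TMem S h (fun u => op.evalF fs ((c : ℝ) + u)) (op.modelW S h D K Ke ke Kl Kt kt c Ws cs).P
  | base op, cs, hok => SOp.tmem_model hS h0 c hst op cs hok
  | sin i, cs, hok => by
      simp only [modelW] at hok ⊢
      exact tmem_sin_of_tsinTMWS hS h0 (hst i) hok
  | cos i, cs, hok => by
      simp only [modelW] at hok ⊢
      exact tmem_cos_of_tcosTMWS hS h0 (hst i) hok

end TOp

namespace AOp

/-- **The statement modeller with range-free `sin` / `cos` and sharp `arctan`**: `TOp.modelW` for a `base` statement,
`tatanTMS` of the operand's register model for `atan`. [cite: Joldes2011, Algorithm 2.2.10] -/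
def modelSW (S : ℕ) (h : ℚ) (D K Ke ke Kl Kt kt Ka : ℕ) (c : ℚ) (Ws : List IPoly) :
    AOp → List (List ℤ × ℕ) → WExpr.MRes
  | base op, cs => op.modelW S h D K Ke ke Kl Kt kt c Ws cs
  | atan i, cs =>
      let t := tatanTMS S h D K Ka (getReg [] Ws i)
      ⟨t.1, cs, t.2⟩

/-- **Soundness of `AOp.modelSW`** under the stack invariant. [cite: Joldes2011, Algorithm 2.2.10] -/
theorem tmem_modelSW {S : ℕ} (hS : 0 < S) {h : ℚ} (h0 : 0 ≤ h) {D K Ke ke Kl Kt kt Ka : ℕ} (c : ℚ)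
    {fs : List (ℝ → ℝ)} {Ws : List IPoly} (hst : StackMem S h c fs Ws) :
    ∀ (op : AOp) (cs : List (List ℤ × ℕ)), (op.modelSW S h D K Ke ke Kl Kt kt Ka c Ws cs).ok = true →
      TMem S h (fun u => op.evalF fs ((c : ℝ) + u)) (op.modelSW S h D K Ke ke Kl Kt kt Ka c Ws cs).P
  | base op, cs, hok => TOp.tmem_modelW hS h0 c hst op cs hok
  | atan i, cs, hok => by
      simp only [modelSW] at hok ⊢
      exact tmem_atan_of_tatanTMS hS h0 (hst i) hok

end AOp

/-- The `TOp` family with range-free `sin` / `cos`: statements `TOp`, parameters `TrigPrm`, modeller `TOp.modelW`.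
[cite: Melquiond2008, Sect. 3.3] -/
abbrev OpModel.trigWide : OpModel :=
  ⟨TOp, TrigPrm, fun prm S h c Ws op cs => op.modelW S h prm.D prm.K prm.Ke prm.ke prm.Kl prm.Kt prm.kt c Ws cs⟩

/-- Its semantics (`TOp.evalF`, the same as `OpSem.trig`) and soundness `TOp.tmem_modelW`. [cite: Melquiond2008, Sect. 3.3] -/
noncomputable def OpSem.trigWide : OpSem OpModel.trigWide where
  evalF := TOp.evalF
  measurable_evalF := fun hfs op => OpSem.trig.measurable_evalF hfs op
  tmem_model := fun _ _ hS _ h0 c _ _ hst op cs hok => TOp.tmem_modelW hS h0 c hst op cs hok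

/-- The `AOp` family with range-free `sin` / `cos` and sharp `arctan`: statements `AOp`, parameters `AtanPrm`,
modeller `AOp.modelSW`. [cite: Melquiond2008, Sect. 3.3] -/
abbrev OpModel.atanSharpWide : OpModel :=
  ⟨AOp, AtanPrm, fun prm S h c Ws op cs =>
    op.modelSW S h prm.D prm.K prm.Ke prm.ke prm.Kl prm.Kt prm.kt prm.Ka c Ws cs⟩

/-- Its semantics (`AOp.evalF`, the same as `OpSem.atan`) and soundness `AOp.tmem_modelSW`. [cite: Melquiond2008, Sect. 3.3] -/
noncomputable def OpSem.atanSharpWide : OpSem OpModel.atanSharpWide where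
  evalF := AOp.evalF
  measurable_evalF := fun hfs op => OpSem.atan.measurable_evalF hfs op
  tmem_model := fun _ _ hS _ h0 c _ _ hst op cs hok => AOp.tmem_modelSW hS h0 c hst op cs hok

/-- [folklore] -/
private theorem runF_trigWide : ∀ (p : TProg) (fs : List (ℝ → ℝ)), OpSem.trigWide.runF p fs = p.runF fs
  | [], _ => rfl
  | _ :: p, _ => runF_trigWide p _

/-- [folklore] -/
private theorem runF_atanSharpWide : ∀ (p : AProg) (fs : List (ℝ → ℝ)), OpSem.atanSharpWide.runF p fs = p.runF fs
  | [], _ => rfl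
  | _ :: p, _ => runF_atanSharpWide p _

/-- The denoted function of a `TOp` program under the wide family is `TProg.toFunP` (the modeller does not enter the
semantics). [cite: MahboubiMelquiondSibutpinote2016, Sect. 4.1] -/
@[simp] theorem toFunP_trigWide (p : TProg) (ps : List ℝ) : OpSem.trigWide.toFunP p ps = p.toFunP ps := by
  unfold OpSem.toFunP TProg.toFunP; rw [runF_trigWide]

/-- The denoted function of an `AOp` program under the sharp-wide family is `AProg.toFunP`.
[cite: MahboubiMelquiondSibutpinote2016, Sect. 4.1] -/
@[simp] theorem toFunP_atanSharpWide (p : AProg) (ps : List ℝ) : OpSem.atanSharpWide.toFunP p ps = p.toFunP ps := by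
  unfold OpSem.toFunP AProg.toFunP; rw [runF_atanSharpWide]

end PolyMP

end Literature.Analysis.ValidatedNumerics
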